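import Literature.MathematicalPhysics.QuantumFieldTheory.Balaban1983to89.T4CouplingMatching

/-!
# Spine/NE4/KingCurrency — node U2 run DIRECTLY on the cutoff pair `(K, K + n)`: what the β-side must supply in
# King's currency is a RATE-FREE n-shift modulus `ω_j → 0`, not NE4's geometric (nor any summable) η-rate

Cell `pub-balaban-gaps` (YM blitz G2), seat `ne4` generation 13 (unit `pub-balaban-gaps-ne4-g13`), record `HOME/ne/NE4.md` §5
census item (R51).  Sibling of `Spine/NE4/Targets` (p338704), `Spine/NE4/Necessity` (p339922) and of the ne9 seat's King-currency
files `Spine/NE9/DirectPairing` ∕ `DirectPairingCauchy` (node U6 organised as in C. King's printed template: the runs with `K` and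
`K + n` steps compared AT ONCE, so that node U6 needs remainders TENDING TO ZERO uniformly in `n` — a c₀ condition — instead of
SUMMABLE consecutive remainders).

WHY.  The tree's node U2 (`T4CouplingMatching.disc_step` ∕ `twoSided_fixedPoint` ∕ `disc_le_of_fadingMemory`) compares CONSECUTIVE
cutoffs (run A: `K` steps, run B: `K + 1` steps) and consumes NE4 = `ScaleShiftRate c θ γ β` as a GEOMETRIC source `c·θ^j`; the ne9
seat's U2 dictionary (`DirectPairing` §5) then needs node U2's consecutive output to be SUMMABLE in the scale index to telescope it
into an `n`-uniform direct profile — whence the cell's booking «ℓ¹ is the floor» for the β-side ((R9′) of the record).  THIS FILE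
runs node U2 ITSELF on the pair `(K, K + n)` (run B has `n` unpaired bare couplings `g^B_0, …, g^B_{n−1}`; scale `j` of run A is
infrared-matched with scale `j + n` of run B; both pinned at the renormalized coupling, `g^A_K = g^B_{K+n}`):
* §1 `UniformShift ω γ β` — the β-side input in King's currency: the n-SHIFT modulus
  `|β_{j+n+1}(g_0,…,g_{j+n}) − β_{j+1}(g_n,…,g_{j+n})| ≤ ω_j` for ALL `n` (only `ω_j → 0` will ever be used: RATE-FREE uniform
  stationarity of `β_k` in the cutoff).  NE4 implies it with `ω_j = cθ^j∕(1−θ)` (`uniformShift_of_scaleShiftRate`, telescoping);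
  the converse fails (§1b).
* §2 `discAt n gA gB j = |1∕(g^A_j)² − 1∕(g^B_{j+n})²|` and the DIRECT backward recursion `discAt_step`:
  `δ_j ≤ δ_{j+1} + ω_j + Σ_{i≤j} Λ_{j,i}·|g^B_{i+n} − g^A_i|` (subtract (0.20) of run A at step `j` from (0.20) of run B at step
  `j + n` — an identity — then `UniformShift` at run B's prefix and `HistLipschitz` at scale `j`).
* §3 `king_fixedPoint` — the INFRARED-ANCHORED fixed point replacing `twoSided_fixedPoint`: on a window `[J, K]`, with fading
  feedback `C·θ^{j−i}`, window weights of total `≤ U` and the SAME AF smallness `C·U ≤ (1−θ)∕2` as the consecutive kernel,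
  `x_j ≤ 2·Σ_{i∈[J,K)} ω_i + 2(C∕(1−θ))·Φ`, `Φ` = the far-ultraviolet scales seen through the fading memory; NO rate is propagated.
* §1b the converse fails: `harmonicOsc` (bounded, history-free, `ω_j = 2∕(j+1) → 0`) violates `ScaleShiftRate c θ γ` for every
  `c` and every `θ < 1`.  Siblings: `Spine/NE4/KingCurrencyWindow` (node U2's direct END on two pinned runs `n` cutoffs apart —
  `discAt ≤ 2·Σ_{window} ω + far-UV term through the fading memory`, the far-UV term small by asymptotic freedom, the qualitative
  END uniformly in `n`) and `Spine/NE4/KingCurrencyTransport` (node U6's transport absorbs the infrared anchoring).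

WHAT THIS SAYS FOR THE ROW (R51).  What NE4 is FOR — full-sequence convergence at the apex, `T4Assembly.GenFunCauchy` = Cauchy-ness
of the generating functions — needs from the β-side, on King's route, only `UniformShift ω` with `ω → 0`: NOT the geometric rate of
NE4, NOT the ℓ¹ envelope of (R9′) (both bookings are relative to the CONSECUTIVE organisation of nodes U2∕U6, exactly as the ne9
seat's C26∕C30 found for the E-side).  NE4 PROPER is unchanged (NOT PRINTED, NOT PROVED, DEPENDENT = (R)∘{NE5, NE9}); what changes
is the located upstream of the spine's β-side NEED: uniform (in the history box) convergence of `β_k` as the cutoff is removed —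
compactness-grade (η-uniform bounds and equicontinuity are printed TYPE, [Balaban1987RG1] p. 264; identification of the limit
functional is the content), not an η-difference theory with a rate.  The E-side sockets of `Spine/NE9/DirectPairing*` take
`K`-uniform profiles; the rate-free output here is infrared-anchored (small at fixed depth below the IR end, not at fixed height
above the UV end), which node U6's transport `ρ^m` absorbs (`KingCurrencyTransport.tendsto_delta_of_irAnchored`); re-cutting the
E-side bracket to the anchored form is recorded as the successor's item, not done here.

HONEST FRAMING.  Elementary real analysis on HYPOTHESIS SHAPES (0 sorry, standard axioms); every β-side shape is an UNPRINTED
binder; nothing of Bałaban's is asserted or instantiated; NE4 NOT IN PRINT ∕ NOT PROVED; spine PROVED 0∕9 before and after this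
file; rung (B)+1 on ONE finite T⁴ — NOT ℝ⁴, NOT infinite volume, NOT a mass gap, NOT Clay.

References (TYPES only): [Balaban1987RG1] = T. Bałaban, Commun. Math. Phys. **109** (1987) 249–301, (0.20) p. 256, Thm 2 p. 259,
(0.31) p. 259, p. 264, §5 p. 298; [King1986] = C. King, Commun. Math. Phys. **102** (1986) 649–677, Thm 3.4 (3.9) p. 656, (3.13) p. 657.
-/

noncomputable section

namespace Summit.QuantumFields.BalabanUV.T4Continuum.Spine.NE4.KingCurrency

open Finset Filter Topology
open Literature.MathematicalPhysics.QuantumFieldTheory.Balaban1983to89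
open Literature.MathematicalPhysics.QuantumFieldTheory.Balaban1983to89.FlowStep
open Literature.MathematicalPhysics.QuantumFieldTheory.Balaban1983to89.T4CouplingMatching

/-! ## §1 The β-side input in King's currency: the n-shift modulus -/

/-- HYPOTHESIS SHAPE — **the β-side input of node U2 in KING's currency**: the n-SHIFT MODULUS of the history-dependent
β-functions.  For every gap `n`, every scale `j` and every coupling sequence `g` with `g_0, …, g_{j+n} ∈ ]0,γ]`:
`|β_{j+n+1}(g_0, …, g_{j+n}) − β_{j+1}(g_n, …, g_{j+n})| ≤ ω_j` — the β-function after `j + n` steps of a run with `n` MORE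
ultraviolet scales, at the infrared-matched history, differs from the one after `j` steps by at most `ω_j`, UNIFORMLY in `n` and
in the history.  Only `ω_j → 0` is ever consumed (rate-free uniform stationarity of `β_k` as the cutoff is removed); NE4 =
`ScaleShiftRate c θ γ β` is the geometric instance `ω_j = cθ^j∕(1−θ)` (`uniformShift_of_scaleShiftRate`).  NOT PRINTED in any form
([Balaban1987RG1] p. 264: «We will investigate other properties in a separate paper»). [cite: Balaban1987RG1, §1 p.264 and §5 p.298] -/
def UniformShift (ω : ℕ → ℝ) (γ : ℝ) (β : HBeta) : Prop :=
  ∀ (n j : ℕ) (g : ℕ → ℝ), (∀ i, i ≤ j + n → 0 < g i ∧ g i ≤ γ) →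
    |β (j + n) (prefixOf g (j + n)) - β j (prefixOf (fun i => g (i + n)) j)| ≤ ω j

/-- On a non-empty box the modulus is nonnegative (test with `n = 0`). [folklore] -/
theorem UniformShift.nonneg {ω : ℕ → ℝ} {γ : ℝ} {β : HBeta} (h : UniformShift ω γ β) (hγ : 0 < γ) (j : ℕ) :
    0 ≤ ω j :=
  (abs_nonneg _).trans (h 0 j (fun _ => γ) fun _ _ => ⟨hγ, le_rfl⟩)

/-- TELESCOPING THE SINGLE SHIFTS: under NE4 = `ScaleShiftRate c θ γ β`, the n-shift at scale `j` is bounded by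
`Σ_{s<n} c·θ^{j+s}` (induction on `n`; each step is one instance of `ScaleShiftRate` at run B's prefix, `tail_prefixOf`). [folklore] -/
theorem shift_le_sum_of_scaleShiftRate {c θ γ : ℝ} {β : HBeta} (hS : ScaleShiftRate c θ γ β) :
    ∀ (n j : ℕ) (g : ℕ → ℝ), (∀ i, i ≤ j + n → 0 < g i ∧ g i ≤ γ) →
      |β (j + n) (prefixOf g (j + n)) - β j (prefixOf (fun i => g (i + n)) j)|
        ≤ ∑ s ∈ range n, c * θ ^ (j + s) := by
  intro n
  induction n with
  | zero =>
    intro j g _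
    show |β j (prefixOf g j) - β j (prefixOf g j)| ≤ ∑ s ∈ range 0, c * θ ^ (j + s)
    simp
  | succ n ih =>
    intro j g hg
    have hw : prefixOf g (j + n + 1) ∈ Box γ (j + n + 1) :=
      prefixOf_mem_box (N := j + n + 1) le_rfl fun i hi => hg i (by omega)
    have h1 := hS (j + n) (prefixOf g (j + n + 1)) hw
    rw [tail_prefixOf] at h1
    have h2 := ih j (fun i => g (i + 1)) fun i hi => hg (i + 1) (by omega)
    beta_reduce at h2
    have t := abs_sub_le (β (j + n + 1) (prefixOf g (j + n + 1)))
      (β (j + n) (prefixOf (fun i => g (i + 1)) (j + n))) (β j (prefixOf (fun i => g (i + n + 1)) j))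
    rw [sum_range_succ]
    show |β (j + n + 1) (prefixOf g (j + n + 1)) - β j (prefixOf (fun i => g (i + n + 1)) j)| ≤ _
    linarith

/-- **NE4 ⇒ THE KING-CURRENCY INPUT**: `ScaleShiftRate c θ γ β` with `0 ≤ θ < 1`, `0 ≤ c` gives
`UniformShift (j ↦ (c∕(1−θ))·θ^j) γ β` (geometric sum).  The converse fails (§1b, `harmonicOsc_not_scaleShiftRate`). [folklore] -/
theorem uniformShift_of_scaleShiftRate {c θ γ : ℝ} {β : HBeta} (hS : ScaleShiftRate c θ γ β)
    (hθ0 : 0 ≤ θ) (hθ1 : θ < 1) (hc : 0 ≤ c) :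
    UniformShift (fun j => c / (1 - θ) * θ ^ j) γ β := by
  intro n j g hg
  refine (shift_le_sum_of_scaleShiftRate hS n j g hg).trans ?_
  have hgeom : ∑ s ∈ range n, θ ^ (j + s) ≤ θ ^ j / (1 - θ) := by
    have e : ∑ s ∈ range n, θ ^ (j + s) = ∑ i ∈ Ico j (j + n), θ ^ i := by
      rw [Finset.sum_Ico_eq_sum_range, Nat.add_sub_cancel_left]
    rw [e]
    exact geom_sum_Ico_le_of_lt_one hθ0 hθ1
  calc ∑ s ∈ range n, c * θ ^ (j + s) = c * ∑ s ∈ range n, θ ^ (j + s) := by rw [Finset.mul_sum]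
    _ ≤ c * (θ ^ j / (1 - θ)) := mul_le_mul_of_nonneg_left hgeom hc
    _ = c / (1 - θ) * θ ^ j := by ring


/-! ## §1b The converse fails: a King-admissible family violating NE4 at every rate -/

/-- WITNESS (MODEL, nothing of Bałaban's): the bounded, history-FREE family `β_{k+1} ≡ (−1)^k∕(k+1)` — an η-dependence of the
β-functions that is alternating and only harmonically small in the number of steps below the cutoff. [folklore] -/
def harmonicOsc : HBeta := fun k _ => (-1 : ℝ) ^ k / ((k : ℝ) + 1)

/-- `harmonicOsc` IS King-admissible: `UniformShift (j ↦ 2∕(j+1)) γ harmonicOsc` (every n-shift is `≤ 1∕(j+n+1) + 1∕(j+1)`).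
[folklore] -/
theorem harmonicOsc_uniformShift (γ : ℝ) : UniformShift (fun j => 2 / ((j : ℝ) + 1)) γ harmonicOsc := by
  intro n j g _
  have hj1 : (0 : ℝ) < (j : ℝ) + 1 := by positivity
  have hjn1 : (0 : ℝ) < ((j + n : ℕ) : ℝ) + 1 := by positivity
  have h1 : |(-1 : ℝ) ^ (j + n) / (((j + n : ℕ) : ℝ) + 1)| ≤ 1 / ((j : ℝ) + 1) := by
    rw [abs_div, abs_pow, abs_neg, abs_one, one_pow, abs_of_pos hjn1]
    exact one_div_le_one_div_of_le hj1 (by push_cast; linarith)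
  have h2 : |(-1 : ℝ) ^ j / ((j : ℝ) + 1)| ≤ 1 / ((j : ℝ) + 1) := by
    rw [abs_div, abs_pow, abs_neg, abs_one, one_pow, abs_of_pos hj1]
  show |(-1 : ℝ) ^ (j + n) / (((j + n : ℕ) : ℝ) + 1) - (-1 : ℝ) ^ j / ((j : ℝ) + 1)| ≤ 2 / ((j : ℝ) + 1)
  calc |(-1 : ℝ) ^ (j + n) / (((j + n : ℕ) : ℝ) + 1) - (-1 : ℝ) ^ j / ((j : ℝ) + 1)|
      ≤ |(-1 : ℝ) ^ (j + n) / (((j + n : ℕ) : ℝ) + 1)| + |(-1 : ℝ) ^ j / ((j : ℝ) + 1)| := abs_sub _ _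
    _ ≤ 1 / ((j : ℝ) + 1) + 1 / ((j : ℝ) + 1) := add_le_add h1 h2
    _ = 2 / ((j : ℝ) + 1) := by ring

/-- … and its modulus tends to zero: the King route accepts `harmonicOsc`. [folklore] -/
theorem tendsto_harmonicOsc_modulus : Tendsto (fun j : ℕ => (2 : ℝ) / ((j : ℝ) + 1)) atTop (𝓝 0) := by
  have h := (tendsto_one_div_add_atTop_nhds_zero_nat (𝕜 := ℝ)).const_mul (2 : ℝ)
  rw [mul_zero] at h
  refine Tendsto.congr (fun j => ?_) h
  ring

/-- The single shift of `harmonicOsc` at scale `k` is EXACTLY `1∕(k+2) + 1∕(k+1) ≥ 1∕(k+1)`. [folklore] -/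
theorem harmonicOsc_shift (k : ℕ) (w : Fin (k + 2) → ℝ) :
    |harmonicOsc (k + 1) w - harmonicOsc k (Fin.tail w)| = 1 / ((k : ℝ) + 2) + 1 / ((k : ℝ) + 1) := by
  have hk1 : (0 : ℝ) < (k : ℝ) + 1 := by positivity
  have hk2 : (0 : ℝ) < (k : ℝ) + 2 := by positivity
  show |(-1 : ℝ) ^ (k + 1) / (((k + 1 : ℕ) : ℝ) + 1) - (-1 : ℝ) ^ k / ((k : ℝ) + 1)| = _
  have e : (-1 : ℝ) ^ (k + 1) / (((k + 1 : ℕ) : ℝ) + 1) - (-1 : ℝ) ^ k / ((k : ℝ) + 1)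
      = (-1 : ℝ) ^ k * (-(1 / ((k : ℝ) + 2) + 1 / ((k : ℝ) + 1))) := by
    push_cast
    rw [pow_succ]
    ring
  rw [e, abs_mul, abs_pow, abs_neg, abs_one, one_pow, one_mul, abs_of_neg (by
    have : 1 / ((k : ℝ) + 2) > 0 := by positivity
    have : 1 / ((k : ℝ) + 1) > 0 := by positivity
    linarith)]
  ring

/-- **`harmonicOsc` VIOLATES NE4 AT EVERY RATE**: for `γ > 0`, `0 ≤ θ < 1` and every constant `c`, `¬ ScaleShiftRate c θ γ harmonicOsc`
(the single shift at scale `k` is `≥ 1∕(k+1)`, while `c·(k+1)·θ^k → 0`).  With `harmonicOsc_uniformShift` ∕ `tendsto_harmonicOsc_modulus`: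
the King-currency input is STRICTLY WEAKER than NE4 (and than any summable envelope of the single shifts: `Σ 1∕(k+1) = ∞`).
[folklore] -/
theorem harmonicOsc_not_scaleShiftRate {γ c θ : ℝ} (hγ : 0 < γ) (hθ0 : 0 ≤ θ) (hθ1 : θ < 1) :
    ¬ ScaleShiftRate c θ γ harmonicOsc := by
  intro hS
  -- along the constant history `γ`: `1∕(k+1) ≤ c·θ^k` for every `k`
  have hk : ∀ k : ℕ, 1 / ((k : ℝ) + 1) ≤ c * θ ^ k := by
    intro k
    have hw : (fun _ : Fin (k + 2) => γ) ∈ Box γ (k + 1) := mem_box.mpr fun _ => ⟨hγ, le_rfl⟩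
    have h := hS k (fun _ => γ) hw
    rw [harmonicOsc_shift] at h
    have : (0 : ℝ) < 1 / ((k : ℝ) + 2) := by positivity
    linarith
  -- but `c·(k+1)·θ^k → 0`
  have ht : Tendsto (fun k : ℕ => c * (((k : ℝ) + 1) * θ ^ k)) atTop (𝓝 0) := by
    have h1 := tendsto_self_mul_const_pow_of_lt_one hθ0 hθ1
    have h2 := tendsto_pow_atTop_nhds_zero_of_lt_one hθ0 hθ1
    have h3 : Tendsto (fun k : ℕ => (k : ℝ) * θ ^ k + θ ^ k) atTop (𝓝 (0 + 0)) := h1.add h2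
    rw [add_zero] at h3
    have h4 := h3.const_mul c
    rw [mul_zero] at h4
    refine Tendsto.congr (fun k => ?_) h4
    ring
  obtain ⟨k, hk'⟩ := ((tendsto_order.1 ht).2 1 zero_lt_one).exists
  have h1 := hk k
  have hk1 : (0 : ℝ) < (k : ℝ) + 1 := by positivity
  -- `1 ≤ (k+1)·c·θ^k < 1`
  have h2 : 1 ≤ c * (((k : ℝ) + 1) * θ ^ k) := by
    have := (div_le_iff₀ hk1).mp h1
    linarith
  linarith

/-! ## §2 The direct discrepancy of two runs `n` cutoffs apart, and its backward recursion -/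

/-- The COUPLING DISCREPANCY of runs `n` cutoffs apart in the variable `x = 1∕g²` of (0.20): run A's scale `j` against run B's
infrared-matched scale `j + n`, `discAt n gA gB j = |1∕(g^A_j)² − 1∕(g^B_{j+n})²|`; `discAt 1 = T4CouplingMatching.disc`.
[cite: Balaban1987RG1, (0.20) p.256] -/
def discAt (n : ℕ) (gA gB : ℕ → ℝ) (j : ℕ) : ℝ := |1 / (gA j) ^ 2 - 1 / (gB (j + n)) ^ 2|

/-- `discAt ≥ 0`. [folklore] -/
theorem discAt_nonneg (n : ℕ) (gA gB : ℕ → ℝ) (j : ℕ) : 0 ≤ discAt n gA gB j := abs_nonneg _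

/-- The consecutive case is the tree's `disc`. [folklore] -/
theorem discAt_one (gA gB : ℕ → ℝ) : discAt 1 gA gB = disc gA gB := rfl

/-- THE INFRARED PIN of the pair: `g^A_K = g^B_{K+n}` (both runs end at the renormalized coupling) gives `discAt n gA gB K = 0`.
[cite: Balaban1987RG1, Thm 2 p.259] -/
theorem discAt_pin {n K : ℕ} {gA gB : ℕ → ℝ} (hpin : gA K = gB (K + n)) : discAt n gA gB K = 0 := by
  simp [discAt, hpin]

/-- Index bookkeeping: `discAt n gA gB (j+1) = |1∕(g^A_{j+1})² − 1∕(g^B_{j+n+1})²|`. [folklore] -/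
theorem discAt_succ (n : ℕ) (gA gB : ℕ → ℝ) (j : ℕ) :
    discAt n gA gB (j + 1) = |1 / (gA (j + 1)) ^ 2 - 1 / (gB (j + n + 1)) ^ 2| := by
  simp only [discAt, Nat.add_right_comm j 1 n]

/-- The coupling difference is controlled by the discrepancy with the asymptotic-freedom weight:
`|g^B_{j+n} − g^A_j| ≤ (g^A_j)² g^B_{j+n} · discAt n gA gB j` (`abs_sub_le_of_inv_sq`). [folklore] -/
theorem abs_sub_le_weight_mul_discAt {n j : ℕ} {gA gB : ℕ → ℝ} (hA : 0 < gA j) (hB : 0 < gB (j + n)) :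
    |gB (j + n) - gA j| ≤ (gA j) ^ 2 * gB (j + n) * discAt n gA gB j := by
  rw [abs_sub_comm]
  exact abs_sub_le_of_inv_sq hA hB

/-- **THE DIRECT BACKWARD RECURSION** (node U2 on the pair `(K, K+n)`): two runs of (0.20) with the same history-dependent `β` —
A: `K` steps, B: `K + n` steps, couplings in `]0,γ]` — the King-currency input `UniformShift ω γ β` and history moduli
`HistLipschitz Λ γ β`.  Then for `j < K`:
`discAt_j ≤ discAt_{j+1} + ω_j + Σ_{i≤j} Λ_{j,i}·|g^B_{i+n} − g^A_i|`
(subtract (0.20) of run A at step `j` from (0.20) of run B at step `j + n`: the β-difference splits into the n-SHIFT at B's prefix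
and the history shift at scale `j`).  β-side hypotheses UNPRINTED binders. [cite: Balaban1987RG1, (0.20) p.256] -/
theorem discAt_step {β : HBeta} {γ : ℝ} {ω : ℕ → ℝ} {Λ : ℕ → ℕ → ℝ} {K n : ℕ} {gA gB : ℕ → ℝ}
    (hA : RGEqH K β gA) (hB : RGEqH (K + n) β gB)
    (hAbox : ∀ i, i ≤ K → 0 < gA i ∧ gA i ≤ γ) (hBbox : ∀ i, i ≤ K + n → 0 < gB i ∧ gB i ≤ γ)
    (hS : UniformShift ω γ β) (hL : HistLipschitz Λ γ β) {j : ℕ} (hj : j < K) :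
    discAt n gA gB j ≤ discAt n gA gB (j + 1) + ω j
      + ∑ i ∈ range (j + 1), Λ j i * |gB (i + n) - gA i| := by
  have eA := hA j hj
  have eB := hB (j + n) (by omega)
  have hpA : prefixOf gA j ∈ Box γ j := prefixOf_mem_box hj.le hAbox
  have hpB : prefixOf (fun i => gB (i + n)) j ∈ Box γ j :=
    prefixOf_mem_box (N := K) hj.le fun i hi => hBbox (i + n) (by omega)
  have h1 := hS n j gB fun i hi => hBbox i (by omega)
  have h2 := hL j (prefixOf (fun i => gB (i + n)) j) (prefixOf gA j) hpB hpA
  have h3 : ∑ i : Fin (j + 1), Λ j i * |prefixOf (fun i => gB (i + n)) j i - prefixOf gA j i|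
      = ∑ i ∈ range (j + 1), Λ j i * |gB (i + n) - gA i| := by
    rw [Finset.sum_range (fun i => Λ j i * |gB (i + n) - gA i|)]
    simp only [prefixOf_apply]
  rw [h3] at h2
  have key : 1 / gA j ^ 2 - 1 / gB (j + n) ^ 2
      = (1 / gA (j + 1) ^ 2 - 1 / gB (j + n + 1) ^ 2)
        + (β j (prefixOf gA j) - β j (prefixOf (fun i => gB (i + n)) j))
        - (β (j + n) (prefixOf gB (j + n)) - β j (prefixOf (fun i => gB (i + n)) j)) := by
    rw [eA, eB]
    ring
  have habs : discAt n gA gB j ≤ discAt n gA gB (j + 1)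
      + |β j (prefixOf gA j) - β j (prefixOf (fun i => gB (i + n)) j)|
      + |β (j + n) (prefixOf gB (j + n)) - β j (prefixOf (fun i => gB (i + n)) j)| := by
    rw [discAt_succ]
    unfold discAt
    rw [key]
    exact (abs_sub _ _).trans (add_le_add (abs_add_le _ _) le_rfl)
  have hcomm : |β j (prefixOf gA j) - β j (prefixOf (fun i => gB (i + n)) j)|
      = |β j (prefixOf (fun i => gB (i + n)) j) - β j (prefixOf gA j)| := abs_sub_comm _ _
  linarith [habs, hcomm, h1, h2]

/-! ## §3 The infrared-anchored fixed point (replaces `twoSided_fixedPoint`; no rate is propagated) -/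

/-- A shifted geometric sum over a window: `Σ_{j∈[A,K)} θ^{j−i} ≤ 1∕(1−θ)` for `i ≤ A`. [folklore] -/
theorem sum_Ico_pow_sub_le {θ : ℝ} (hθ0 : 0 ≤ θ) (hθ1 : θ < 1) {i A K : ℕ} (hiA : i ≤ A) :
    ∑ j ∈ Ico A K, θ ^ (j - i) ≤ 1 / (1 - θ) := by
  calc ∑ j ∈ Ico A K, θ ^ (j - i) ≤ ∑ j ∈ Ico i K, θ ^ (j - i) :=
        Finset.sum_le_sum_of_subset_of_nonneg
          (fun j hj => Finset.mem_Ico.mpr ⟨hiA.trans (Finset.mem_Ico.mp hj).1, (Finset.mem_Ico.mp hj).2⟩)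
          fun _ _ _ => pow_nonneg hθ0 _
    _ = ∑ m ∈ range (K - i), θ ^ m := by
        rw [Finset.sum_Ico_eq_sum_range]
        refine Finset.sum_congr rfl fun m _ => ?_
        rw [Nat.add_sub_cancel_left]
    _ ≤ 1 / (1 - θ) := by
        have h : ∑ m ∈ Ico 0 (K - i), θ ^ m ≤ θ ^ 0 / (1 - θ) := geom_sum_Ico_le_of_lt_one hθ0 hθ1
        rw [pow_zero] at h
        rw [Finset.range_eq_Ico]
        exact h

/-- **THE INFRARED-ANCHORED FIXED POINT.**  Scales `0 … K`, a window `[J, K]`; a nonnegative sequence `x` pinned at the infrared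
end (`x_K = 0`) with the backward recursion, for `J ≤ j < K`,
`x_j ≤ x_{j+1} + ω_j + C·θ^{j−J}·Φ + C·Σ_{i∈[J,j]} θ^{j−i}·(u_i x_i)`
(source `ω ≥ 0`; far-ultraviolet input `Φ ≥ 0` entering through the fading memory only; window feedback with weights `u ≥ 0`,
`Σ_{i∈[J,K)} u_i ≤ U`), and the smallness `C·U ≤ (1−θ)∕2`.  THEN for every `j ∈ [J, K]`:
`x_j ≤ 2·Σ_{i∈[J,K)} ω_i + 2·(C∕(1−θ))·Φ`.
Proof: backward accumulation from the pin; EXCHANGE of the double sum — each window scale `i` feeds the accumulated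
discrepancy at most `u_i x_i∕(1−θ)` in total (`sum_Ico_pow_sub_le`), which is where fading memory is spent; bootstrap on the
window maximum.  No geometric envelope, no rate. [folklore] -/
theorem king_fixedPoint {K J : ℕ} (hJK : J ≤ K) {x ω u : ℕ → ℝ} {θ C U Φ : ℝ}
    (hθ0 : 0 ≤ θ) (hθ1 : θ < 1) (hC : 0 ≤ C) (hΦ : 0 ≤ Φ)
    (hx : ∀ j, 0 ≤ x j) (hω : ∀ j, 0 ≤ ω j) (hu : ∀ i, 0 ≤ u i)
    (hU : ∑ i ∈ Ico J K, u i ≤ U) (hsmall : C * U ≤ (1 - θ) / 2) (hK : x K = 0)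
    (hrec : ∀ j, J ≤ j → j < K →
      x j ≤ x (j + 1) + ω j + C * θ ^ (j - J) * Φ
        + C * ∑ i ∈ Ico J (j + 1), θ ^ (j - i) * (u i * x i)) :
    ∀ j, J ≤ j → j ≤ K → x j ≤ 2 * ∑ i ∈ Ico J K, ω i + 2 * (C / (1 - θ)) * Φ := by
  have h1θ : 0 < 1 - θ := by linarith
  -- the window maximum
  obtain ⟨js, hjs, hmax⟩ := Finset.exists_max_image (Icc J K) x ⟨J, Finset.mem_Icc.mpr ⟨le_rfl, hJK⟩⟩
  set Y := x js with hY
  have hY0 : 0 ≤ Y := hx js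
  have hxY : ∀ i, J ≤ i → i ≤ K → x i ≤ Y := fun i hi hiK => hmax i (Finset.mem_Icc.mpr ⟨hi, hiK⟩)
  -- the per-scale increment, with the window feedback bounded by `Y`
  set s : ℕ → ℝ := fun j => ω j + C * θ ^ (j - J) * Φ + C * ∑ i ∈ Ico J (j + 1), θ ^ (j - i) * (u i * x i)
    with hs
  have hs0 : ∀ j, 0 ≤ s j := fun j => by
    have h1 : 0 ≤ ∑ i ∈ Ico J (j + 1), θ ^ (j - i) * (u i * x i) :=
      Finset.sum_nonneg fun i _ => mul_nonneg (pow_nonneg hθ0 _) (mul_nonneg (hu i) (hx i))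
    have h2 : 0 ≤ C * θ ^ (j - J) * Φ := mul_nonneg (mul_nonneg hC (pow_nonneg hθ0 _)) hΦ
    have h3 := hω j
    have h4 := mul_nonneg hC h1
    simp only [hs]
    linarith
  -- backward accumulation on the window, via the tree's `backward_sum` applied to `j ↦ x (max j J)`
  have hacc : ∀ j, J ≤ j → j ≤ K → x j ≤ ∑ i ∈ Ico J K, s i := by
    have hrec' : ∀ j, j < K → x (max j J) ≤ x (max (j + 1) J) + s j := by
      intro j hj
      by_cases hJj : J ≤ j
      · rw [max_eq_left hJj, max_eq_left (by omega : J ≤ j + 1)]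
        simp only [hs]
        have h := hrec j hJj hj
        linarith
      · have e1 : max j J = J := max_eq_right (by omega)
        have e2 : max (j + 1) J = J := max_eq_right (by omega)
        rw [e1, e2]
        linarith [hs0 j]
    have hKJ : x (max K J) ≤ 0 := by rw [max_eq_left hJK, hK]
    intro j hJj hjK
    have h := backward_sum (δ := fun j => x (max j J)) hKJ hrec' j hjK
    simp only [max_eq_left hJj] at h
    exact h.trans (Finset.sum_le_sum_of_subset_of_nonneg (Finset.Ico_subset_Ico hJj le_rfl)
      fun i _ _ => hs0 i)
  -- the accumulated increment: sources + far-UV through fading memory + window feedback (exchange of sums)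
  have hgeomJ : ∑ j ∈ Ico J K, θ ^ (j - J) ≤ 1 / (1 - θ) := sum_Ico_pow_sub_le hθ0 hθ1 le_rfl
  have hexch : ∑ j ∈ Ico J K, ∑ i ∈ Ico J (j + 1), θ ^ (j - i) * (u i * x i)
      = ∑ i ∈ Ico J K, ∑ j ∈ Ico i K, θ ^ (j - i) * (u i * x i) := by
    refine Finset.sum_comm' fun j i => ?_
    simp only [Finset.mem_Ico]
    omega
  have hfeed : ∑ j ∈ Ico J K, ∑ i ∈ Ico J (j + 1), θ ^ (j - i) * (u i * x i) ≤ U * Y / (1 - θ) := by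
    rw [hexch]
    calc ∑ i ∈ Ico J K, ∑ j ∈ Ico i K, θ ^ (j - i) * (u i * x i)
        = ∑ i ∈ Ico J K, (u i * x i) * ∑ j ∈ Ico i K, θ ^ (j - i) := by
          refine Finset.sum_congr rfl fun i _ => ?_
          rw [Finset.mul_sum]
          refine Finset.sum_congr rfl fun j _ => ?_
          ring
      _ ≤ ∑ i ∈ Ico J K, (u i * Y) * (1 / (1 - θ)) := by
          refine Finset.sum_le_sum fun i hi => ?_
          have hiK : i ≤ K := (Finset.mem_Ico.mp hi).2.le
          exact mul_le_mul (mul_le_mul_of_nonneg_left (hxY i (Finset.mem_Ico.mp hi).1 hiK) (hu i))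
            (sum_Ico_pow_sub_le hθ0 hθ1 le_rfl)
            (Finset.sum_nonneg fun _ _ => pow_nonneg hθ0 _) (mul_nonneg (hu i) hY0)
      _ = (∑ i ∈ Ico J K, u i) * Y / (1 - θ) := by
          rw [Finset.sum_mul, Finset.sum_div]
          refine Finset.sum_congr rfl fun i _ => ?_
          ring
      _ ≤ U * Y / (1 - θ) := by
          refine div_le_div_of_nonneg_right ?_ h1θ.le
          exact mul_le_mul_of_nonneg_right hU hY0
  have htot : ∑ i ∈ Ico J K, s i
      ≤ ∑ i ∈ Ico J K, ω i + C * Φ * (1 / (1 - θ)) + C * (U * Y / (1 - θ)) := by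
    have e : ∑ i ∈ Ico J K, s i = ∑ i ∈ Ico J K, ω i + C * Φ * ∑ j ∈ Ico J K, θ ^ (j - J)
        + C * ∑ j ∈ Ico J K, ∑ i ∈ Ico J (j + 1), θ ^ (j - i) * (u i * x i) := by
      simp only [hs, Finset.sum_add_distrib, Finset.mul_sum]
      refine congrArg₂ (· + ·) (congrArg₂ (· + ·) rfl (Finset.sum_congr rfl fun j _ => by ring)) rfl
    rw [e]
    have hCΦ : 0 ≤ C * Φ := mul_nonneg hC hΦ
    nlinarith [mul_le_mul_of_nonneg_left hgeomJ hCΦ, mul_le_mul_of_nonneg_left hfeed hC]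
  -- bootstrap on the maximum
  have hYle : Y ≤ ∑ i ∈ Ico J K, ω i + C * Φ * (1 / (1 - θ)) + C * (U * Y / (1 - θ)) :=
    (hacc js (Finset.mem_Icc.mp hjs).1 (Finset.mem_Icc.mp hjs).2).trans htot
  have hCU : C * (U * Y / (1 - θ)) ≤ Y / 2 := by
    rw [show C * (U * Y / (1 - θ)) = (C * U) * Y / (1 - θ) by ring, div_le_iff₀ h1θ]
    nlinarith [mul_le_mul_of_nonneg_right hsmall hY0]
  have hYfin : Y ≤ 2 * ∑ i ∈ Ico J K, ω i + 2 * (C / (1 - θ)) * Φ := by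
    have : C * Φ * (1 / (1 - θ)) = (C / (1 - θ)) * Φ := by ring
    linarith
  intro j hJj hjK
  exact (hxY j hJj hjK).trans hYfin

end Summit.QuantumFields.BalabanUV.T4Continuum.Spine.NE4.KingCurrency
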